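import Literature.Topology.FourManifolds.CircleProdSumAdditivity
import Literature.Topology.FourManifolds.LoopSurgeryTrisectionEulerProofs
import Literature.Topology.FourManifolds.ReducibleTrisectionSplitting
import Literature.Topology.FourManifolds.ConnectedSumSummandOrientation
import Literature.Topology.FourManifolds.TrisectionOneHandlesLeGenus
import Literature.Topology.FourManifolds.LargeKTrisectionClassificationUniv
import HarnessLib

/-!
# Meier–Schirmer–Zupan, Thm. 1.2: the assembly step of the printed induction (PROVED)

Topic `Literature/Topology/FourManifolds`, proofs companion of `LargeKTrisectionClassification.lean`
(the named fact `Literature.Topology.FourManifolds.msz_trisection_classification_gk`: a closed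
connected oriented smooth `4`-manifold with a `(g; k₁, k₂, k₃)`-trisection, `k₁ ≥ g − 1`, is
`#^{k′}(S¹ × S³)` or `#^{k′}(S¹ × S³) # (±ℂP²)`, `k′ = min{k₂, k₃}`).  The fact is NOT discharged
here.  Its printed proof (MSZ, Proc. AMS 144 (2016), §5) is an induction on `g` through the
reducibility of the trisection: "It suffices to show that `𝒯` is reducible, because this implies
that `𝒯` can be written as a connected sum of a `(g′; k₁′, k₂′, k₃′)`–trisection `𝒯′` and a
`(g″; k₁″, k₂″, k₃″)`–trisection `𝒯″` […]. By the inductive hypothesis, both `𝒯′` and `𝒯″` satisfy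
the conclusions of the theorem" — and hence, tacitly, so does `𝒯`: the underlying manifold
`X = X′ # X″` is again of the form `#^{k′}(S¹ × S³)` or `#^{k′}(S¹ × S³) # (±ℂP²)` with the
parameters added.  In the tree's relational language (`IsConnectedSum` along arbitrary discs, no
orientation data; the normal form `IsCircleProdSum`) this tacit step is the connected-sum
arithmetic of `CircleProdSumUniqueness.lean` / `CircleProdSumAdditivity.lean`; this file states
it in exactly the shape of the fact's conclusion,

  `IsCircleProdSum k X ∨ ∃ M (closed connected smooth), IsCircleProdSum k M ∧ IsConnectedSum M ℂP² X`,

so that a future proof of `msz_trisection_classification_gk_holds` (universe `0` suffices: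
`msz_trisection_classification_gk_of_univ`, `LargeKTrisectionClassificationUniv.lean`) only has
to supply the geometric inputs (reducibility, MSZ Thm. 5.1 / Waldhausen; the splitting of
reducible trisections, `Trisection.isConnectedSum_of_reducing_separating` and
`Trisection.isConnectedSum_circleProd_of_reducing_nonseparating`; the genus-`≤ 1` base):

* `Literature.Topology.FourManifolds.msz_conclusion_of_isConnectedSum_right` — if `X₁` satisfies
  the conclusion with `a` summands, `X₂` is a connected sum of `b` copies of `S¹ × S³` and
  `X = X₁ # X₂`, then `X` satisfies the conclusion with `a + b` summands
  (`IsCircleProdSum.add`, `IsCircleProdSum.isConnectedSum_complexProjectivePlane_add`);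
* `Literature.Topology.FourManifolds.msz_conclusion_of_isConnectedSum_left` — the same with the
  pure piece on the left (`IsConnectedSum.symm`);
* `Literature.Topology.FourManifolds.msz_conclusion_of_isConnectedSum_circleProd` — if `X₁`
  satisfies the conclusion with `a` summands and `X = X₁ # (S¹ × S³)` (Mathlib's `Circle × 𝕊³`,
  the output shape of `Trisection.isConnectedSum_circleProd_of_reducing_nonseparating`), then `X`
  satisfies it with `a + 1` summands (`IsCircleProdSum.succ`; with a `ℂP²` summand present, the
  new `S¹ × S³` is recharted on `ℝ⁴`, `exists_circleProdSphereThree_euclidean`, and moved inside,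
  `IsCircleProdSum.isConnectedSum_complexProjectivePlane_add` with `IsCircleProdSum.one_of_diffeomorph`).

* Parameter bookkeeping (Euler characteristic, MSZ Remark 3.12 / Remark 5.2): GIVEN the conclusion
  for a trisected `X`, `k₀ + k₁ + k₂ = g + 2k′` in the `#^{k′}(S¹ × S³)` case and
  `k₀ + k₁ + k₂ + 1 = g + 2k′` in the `ℂP²` case
  (`IsCircleProdSum.sum_handles_eq_of_isGKTrisection`,
  `IsCircleProdSum.sum_handles_succ_eq_of_isGKTrisection_complexProjectivePlane`; from the tree's
  proved `χ(X) = 2 + g − Σkᵢ`, `finRelHomology_and_relEuler_of_isGKTrisection`, and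
  `χ(#ᵏ(S¹ × S³)) = 2 − 2k`, `χ(#ᵏ(S¹ × S³) # ℂP²) = 3 − 2k`, `CircleProdSumEuler.lean`).
* `Literature.Topology.FourManifolds.msz_conclusion_of_splitting` — **the complete inductive step
  of the printed proof, separating case, with the exponents**: if `X = X₁ # X₂` for trisected
  pieces of types `(g₁; k₁)`, `(g₂; k₂)` with `g₁ + g₂ = g`, `k₁ i + k₂ i = k i` (the output of
  `Trisection.isConnectedSum_of_reducing_separating`), `kⱼ 0 ≤ gⱼ` and `g ≤ k 0 + 1`, and both
  pieces satisfy the conclusion of the theorem with their own `k′ⱼ = min (kⱼ 1) (kⱼ 2)`, then `X`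
  satisfies it with `k′ = min (k 1) (k 2)` — the Euler-characteristic bookkeeping shows that at
  most one piece carries `ℂP²` and that `min` is additive here (Remark 5.2).
* `Literature.Topology.FourManifolds.msz_conclusion_of_splitting_circleProd` — the same for the
  non-separating case `X = X₁ # (S¹ × S³)`, `k₁ i + 1 = k i` (the output of
  `Trisection.isConnectedSum_circleProd_of_reducing_nonseparating`).

* `Literature.Topology.FourManifolds.msz_conclusion_of_splitting'` — the same step with the
  bounds `kⱼ 0 ≤ gⱼ` discharged by `IsGKTrisection.le_genus` (`TrisectionOneHandlesLeGenus.lean`).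
* `Literature.Topology.FourManifolds.msz_trisection_classification_gk_of_reducible` — **the whole
  printed induction on `g`, carried out**: GIVEN the two splitting facts of
  `ReducibleTrisectionSplitting.lean` (`Trisection.isConnectedSum_of_reducing_separating`,
  `Trisection.isConnectedSum_circleProd_of_reducing_nonseparating`, at universe `0`), the
  reducibility of `(g; ≥ g − 1, ·, ·)`-trisections of genus `g ≥ 2` (MSZ §5: Thm. 5.1 with
  Waldhausen's theorem — stated as a hypothesis over `Trisection.IsReducible`, not in the tree)
  and the genus-`≤ 1` base (Gay–Kirby §1 — a hypothesis, not in the tree), the fact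
  `msz_trisection_classification_gk` holds in every universe (strong induction on `g`; the
  pieces are orientable, `IsConnectedSum.isOrientable_left/right` of
  `ConnectedSumSummandOrientation.lean`, inherit `gⱼ ≤ kⱼ 0 + 1`, and assemble by the two steps
  above; universe transport `msz_trisection_classification_gk_of_univ`).
* `Literature.Topology.FourManifolds.msz_trisection_classification_gk_of_separatingReducible` —
  **the same induction through SEPARATING reducing curves only**, as the printed sentence
  ("`𝒯` can be written as a connected sum `𝒯′ # 𝒯″` […] `g = g′ + g″`") actually runs: GIVEN the
  separating splitting fact `Trisection.isConnectedSum_of_reducing_separating` alone, the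
  existence for `g ≥ 2` of a reducing curve separating the central surface (hypothesis; for
  `g ≥ 2` any reducing curve yields one by a band sum) and the genus-`≤ 1` base, the fact holds
  in every universe.  This form does not depend on the non-separating splitting fact
  `Trisection.isConnectedSum_circleProd_of_reducing_nonseparating`, which its own file keeps only
  as a frozen record.
* `Literature.Topology.FourManifolds.msz_base_of_genus_le_one` — **the genus-`≤ 1` base from the
  classification of genus-`≤ 1` trisections** ("If `g = 1`, the statement follows from the
  classification of genus one trisections", §5; the six genus one trisections, §3 p. 6; genus
  zero is `S⁴`): GIVEN those classifications at the level of the underlying manifolds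
  (hypotheses; not in the tree), the base hypothesis of the induction holds —
  `#⁰(S¹ × S³) = S⁴`, `ℂP² = S⁴ # ℂP²` (`msz_conclusion_of_diffeomorph_complexProjectivePlane`,
  Kervaire–Milnor's identity element `isConnectedSum_sphere_self_holds`), `S¹ × S³ = #¹(S¹ × S³)`.
* `Literature.Topology.FourManifolds.msz_trisection_classification_gk_of_separatingReducible_of_genus_le_one`
  — the fact from its three printed inputs in classification shape (separating splitting fact;
  separating reducing curves for `g ≥ 2`; genus-`≤ 1` classification).

So a proof of `msz_trisection_classification_gk_holds` by MSZ's induction on `g` needs exactly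
(`msz_trisection_classification_gk_of_separatingReducible`): a separating reducing curve for
`(g; ≥ g − 1, ·, ·)`-trisections of genus `g ≥ 2` (MSZ §5 via Thm. 5.1, Waldhausen and
Lemma 4.4 — not in the tree), the separating splitting fact of
`ReducibleTrisectionSplitting.lean` (unproved), and the genus-`≤ 1` base cases (not in the
tree); orientations of the pieces (`ConnectedSumSummandOrientation.lean`), the bound `kᵢ ≤ g`
(`TrisectionOneHandlesLeGenus.lean`) and the assembly (this file) are proved.
(Two pieces both carrying `ℂP²` do not occur — Remark 5.2; here this is DERIVED from the Euler
characteristic.)  All statements are theorems over existing notions; nothing is defined, no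
named fact is added.

## References

* J. Meier, T. Schirmer, A. Zupan, *Classification of trisections and the Generalized Property R
  Conjecture*, Proc. AMS 144 (2016) 4983–4997 (arXiv:1507.06561): Thm. 1.2, its proof in §5,
  Remark 5.2. [MeierSchirmerZupan2016]
* M. Kervaire, J. Milnor, *Groups of homotopy spheres I*, Ann. of Math. 77 (1963), §2,
  Lemma 2.1. [KervaireMilnorAnnals1963]
-/

noncomputable section

open scoped Manifold ContDiff Topology
open Set
open Literature.AlgebraicTopology.SingularHomology

namespace Literature.Topology.FourManifolds

universe u

section Assembly

variable {a b : ℕ} {X₁ X₂ X : Type}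
  [TopologicalSpace X₁] [T2Space X₁] [SecondCountableTopology X₁]
  [ChartedSpace (EuclideanSpace ℝ (Fin 4)) X₁] [IsManifold (𝓡 4) ∞ X₁] [CompactSpace X₁]
  [ConnectedSpace X₁]
  [TopologicalSpace X₂] [T2Space X₂] [SecondCountableTopology X₂]
  [ChartedSpace (EuclideanSpace ℝ (Fin 4)) X₂] [IsManifold (𝓡 4) ∞ X₂] [CompactSpace X₂]
  [ConnectedSpace X₂]
  [TopologicalSpace X] [T2Space X] [SecondCountableTopology X]
  [ChartedSpace (EuclideanSpace ℝ (Fin 4)) X] [IsManifold (𝓡 4) ∞ X] [CompactSpace X]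

/-- **Assembly step of MSZ's induction, pure piece on the right.**  If the closed connected
smooth `X₁` is `#ᵃ(S¹ × S³)` or `#ᵃ(S¹ × S³) # ℂP²` (the conclusion of
`msz_trisection_classification_gk` with `a` summands, verbatim), the closed connected smooth `X₂`
is `#ᵇ(S¹ × S³)`, and the closed `X` is a connected sum `X₁ # X₂`, then `X` is `#ᵃ⁺ᵇ(S¹ × S³)` or
`#ᵃ⁺ᵇ(S¹ × S³) # ℂP²` ("both `𝒯′` and `𝒯″` satisfy the conclusions of the theorem", MSZ §5;
Kervaire–Milnor's Lemma 2.1 in the form `IsCircleProdSum.add`,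
`IsCircleProdSum.isConnectedSum_complexProjectivePlane_add`).
[cite: MeierSchirmerZupan2016, proof of Thm. 1.2 (§5)] [cite: KervaireMilnorAnnals1963, §2, Lemma 2.1 (p. 505)] -/
theorem msz_conclusion_of_isConnectedSum_right
    (h₁ : IsCircleProdSum a X₁ ∨
      ∃ (M : Type) (_ : TopologicalSpace M) (_ : T2Space M) (_ : SecondCountableTopology M)
        (_ : ChartedSpace (EuclideanSpace ℝ (Fin 4)) M) (_ : IsManifold (𝓡 4) ∞ M)
        (_ : CompactSpace M) (_ : ConnectedSpace M),
        IsCircleProdSum a M ∧ IsConnectedSum (𝓡 4) (𝓡 4) (𝓡 4) M ComplexProjectivePlane X₁)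
    (h₂ : IsCircleProdSum b X₂) (h : IsConnectedSum (𝓡 4) (𝓡 4) (𝓡 4) X₁ X₂ X) :
    IsCircleProdSum (a + b) X ∨
      ∃ (M : Type) (_ : TopologicalSpace M) (_ : T2Space M) (_ : SecondCountableTopology M)
        (_ : ChartedSpace (EuclideanSpace ℝ (Fin 4)) M) (_ : IsManifold (𝓡 4) ∞ M)
        (_ : CompactSpace M) (_ : ConnectedSpace M),
        IsCircleProdSum (a + b) M ∧ IsConnectedSum (𝓡 4) (𝓡 4) (𝓡 4) M ComplexProjectivePlane X := by
  rcases h₁ with h₁ | ⟨M, _, _, _, _, _, _, _, hM, hMC⟩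
  · exact Or.inl (h₁.add b h₂ h)
  · obtain ⟨Y, _, _, _, _, _, _, _, hY, hYC⟩ :=
      hM.isConnectedSum_complexProjectivePlane_add hMC h₂ h
    exact Or.inr ⟨Y, ‹_›, ‹_›, ‹_›, ‹_›, ‹_›, ‹_›, ‹_›, hY, hYC⟩

/-- **Assembly step of MSZ's induction, pure piece on the left**: if `X₁` is `#ᵃ(S¹ × S³)`, `X₂`
is `#ᵇ(S¹ × S³)` or `#ᵇ(S¹ × S³) # ℂP²`, and `X` is a connected sum `X₁ # X₂`, then `X` is
`#ᵃ⁺ᵇ(S¹ × S³)` or `#ᵃ⁺ᵇ(S¹ × S³) # ℂP²` (commute, `IsConnectedSum.symm`, and use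
`msz_conclusion_of_isConnectedSum_right`). [cite: MeierSchirmerZupan2016, proof of Thm. 1.2 (§5)]
[cite: KervaireMilnorAnnals1963, §2, Lemma 2.1 (p. 505)] -/
theorem msz_conclusion_of_isConnectedSum_left (h₁ : IsCircleProdSum a X₁)
    (h₂ : IsCircleProdSum b X₂ ∨
      ∃ (M : Type) (_ : TopologicalSpace M) (_ : T2Space M) (_ : SecondCountableTopology M)
        (_ : ChartedSpace (EuclideanSpace ℝ (Fin 4)) M) (_ : IsManifold (𝓡 4) ∞ M)
        (_ : CompactSpace M) (_ : ConnectedSpace M),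
        IsCircleProdSum b M ∧ IsConnectedSum (𝓡 4) (𝓡 4) (𝓡 4) M ComplexProjectivePlane X₂)
    (h : IsConnectedSum (𝓡 4) (𝓡 4) (𝓡 4) X₁ X₂ X) :
    IsCircleProdSum (a + b) X ∨
      ∃ (M : Type) (_ : TopologicalSpace M) (_ : T2Space M) (_ : SecondCountableTopology M)
        (_ : ChartedSpace (EuclideanSpace ℝ (Fin 4)) M) (_ : IsManifold (𝓡 4) ∞ M)
        (_ : CompactSpace M) (_ : ConnectedSpace M),
        IsCircleProdSum (a + b) M ∧ IsConnectedSum (𝓡 4) (𝓡 4) (𝓡 4) M ComplexProjectivePlane X := by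
  have h' := msz_conclusion_of_isConnectedSum_right h₂ h₁ h.symm
  rw [Nat.add_comm] at h'
  exact h'

end Assembly

section CircleProd

variable {a : ℕ} {X₁ X : Type}
  [TopologicalSpace X₁] [T2Space X₁] [SecondCountableTopology X₁]
  [ChartedSpace (EuclideanSpace ℝ (Fin 4)) X₁] [IsManifold (𝓡 4) ∞ X₁] [CompactSpace X₁]
  [ConnectedSpace X₁]
  [TopologicalSpace X] [T2Space X] [SecondCountableTopology X]
  [ChartedSpace (EuclideanSpace ℝ (Fin 4)) X] [IsManifold (𝓡 4) ∞ X] [CompactSpace X]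

/-- **Assembly step of MSZ's induction, non-separating case.**  If the closed connected smooth
`X₁` is `#ᵃ(S¹ × S³)` or `#ᵃ(S¹ × S³) # ℂP²` and the closed `X` is a connected sum
`X₁ # (S¹ × S³)` with Mathlib's `Circle × 𝕊³` on the product model (the output of
`Trisection.isConnectedSum_circleProd_of_reducing_nonseparating`: "`X = X′ # (S¹ × S³)`, and `T`
can be decomposed as the connected sum of a trisection `T′` of `X′` and the standard genus-one
trisection of `S¹ × S³`"), then `X` is `#ᵃ⁺¹(S¹ × S³)` or `#ᵃ⁺¹(S¹ × S³) # ℂP²`: the constructor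
`IsCircleProdSum.succ` in the first case; in the second, rechart the new summand on `ℝ⁴`
(`exists_circleProdSphereThree_euclidean`, a closed connected `R ≅ S¹ × S³` with
`IsCircleProdSum 1 R`, `IsCircleProdSum.one_of_diffeomorph`) and move the `ℂP²` summand outside
(`IsCircleProdSum.isConnectedSum_complexProjectivePlane_add`).
[cite: MeierSchirmerZupan2016, proof of Thm. 1.2 (§5)] [cite: KervaireMilnorAnnals1963, §2, Lemma 2.1 (p. 505)] -/
theorem msz_conclusion_of_isConnectedSum_circleProd
    (h₁ : IsCircleProdSum a X₁ ∨
      ∃ (M : Type) (_ : TopologicalSpace M) (_ : T2Space M) (_ : SecondCountableTopology M)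
        (_ : ChartedSpace (EuclideanSpace ℝ (Fin 4)) M) (_ : IsManifold (𝓡 4) ∞ M)
        (_ : CompactSpace M) (_ : ConnectedSpace M),
        IsCircleProdSum a M ∧ IsConnectedSum (𝓡 4) (𝓡 4) (𝓡 4) M ComplexProjectivePlane X₁)
    (h : IsConnectedSum (𝓡 4) (𝓡 4) ((𝓡 1).prod (𝓡 3)) X₁
      (Circle × (Metric.sphere (0 : EuclideanSpace ℝ (Fin 4)) 1)) X) :
    IsCircleProdSum (a + 1) X ∨
      ∃ (M : Type) (_ : TopologicalSpace M) (_ : T2Space M) (_ : SecondCountableTopology M)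
        (_ : ChartedSpace (EuclideanSpace ℝ (Fin 4)) M) (_ : IsManifold (𝓡 4) ∞ M)
        (_ : CompactSpace M) (_ : ConnectedSpace M),
        IsCircleProdSum (a + 1) M ∧ IsConnectedSum (𝓡 4) (𝓡 4) (𝓡 4) M ComplexProjectivePlane X := by
  rcases h₁ with h₁ | ⟨M, _, _, _, _, _, _, _, hM, hMC⟩
  · exact Or.inl (.succ h₁ h)
  · haveI := Fact.mk (@finrank_euclideanSpace_fin ℝ _ 4)
    obtain ⟨R, _, _, _, _, _, _, _, -, ⟨Φ⟩⟩ := exists_circleProdSphereThree_euclidean.{0}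
    -- `X = X₁ # R` with `R ≅ S¹ × S³` on `ℝ⁴`, `IsCircleProdSum 1 R`
    have hR : IsConnectedSum (𝓡 4) (𝓡 4) (𝓡 4) X₁ R X :=
      h.of_diffeomorph_right_of_boundaryless Φ.symm (by simp)
        (ContinuousLinearEquiv.ofFinrankEq (by simp)) (ContinuousLinearEquiv.ofFinrankEq (by simp))
    have hR1 : IsCircleProdSum 1 R := IsCircleProdSum.one_of_diffeomorph Φ
    obtain ⟨Y, _, _, _, _, _, _, _, hY, hYC⟩ :=
      hM.isConnectedSum_complexProjectivePlane_add hMC hR1 hR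
    exact Or.inr ⟨Y, ‹_›, ‹_›, ‹_›, ‹_›, ‹_›, ‹_›, ‹_›, hY, hYC⟩

end CircleProd

/-! ### Parameter bookkeeping: the Euler characteristic -/

section Euler

variable {e g : ℕ} {k : Fin 3 → ℕ} {X : Type} [TopologicalSpace X] [T2Space X]
  [SecondCountableTopology X] [ChartedSpace (EuclideanSpace ℝ (Fin 4)) X] [IsManifold (𝓡 4) ∞ X]
  [CompactSpace X] {S : Fin 3 → Set X}

/-- **`k₀ + k₁ + k₂ = g + 2k′` for a `(g; k)`-trisected `#^{k′}(S¹ × S³)`**: compare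
`χ(X) = 2 + g − (k₀ + k₁ + k₂)` (Gay–Kirby Remark 2 / MSZ Remark 3.12, the tree's proved
`finRelHomology_and_relEuler_of_isGKTrisection`) with `χ(#^{k′}(S¹ × S³)) = 2 − 2k′`
(`IsCircleProdSum.finRelHomology_and_relEuler_eq`).  With `k₀ = g` this is MSZ's Remark 5.2,
"if `𝒯` is a `(g; g, k₂, k₃)`–trisection, then `k₂ = k₃`". [cite: MeierSchirmerZupan2016, Remark 3.12 and Remark 5.2]
[cite: GayKirby2016, Remark 2] -/
theorem IsCircleProdSum.sum_handles_eq_of_isGKTrisection (h : IsCircleProdSum e X)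
    (hT : IsGKTrisection X g k S) : k 0 + k 1 + k 2 = g + 2 * e := by
  have h1 := (finRelHomology_and_relEuler_of_isGKTrisection hT).2
  have h2 := h.finRelHomology_and_relEuler_eq.2
  rw [h1] at h2
  push_cast at h2
  omega

/-- **`k₀ + k₁ + k₂ + 1 = g + 2k′` for a `(g; k)`-trisected `#^{k′}(S¹ × S³) # ℂP²`**: compare
`χ(X) = 2 + g − (k₀ + k₁ + k₂)` (`finRelHomology_and_relEuler_of_isGKTrisection`) with
`χ(#^{k′}(S¹ × S³) # ℂP²) = 3 − 2k′`
(`IsCircleProdSum.relEuler_eq_of_isConnectedSum_complexProjectivePlane`).  With `k₀ = g − 1`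
this is MSZ's Remark 5.2: a `ℂP²` summand forces the parameters `(g; g − 1, k₃, k₃)`.
[cite: MeierSchirmerZupan2016, Remark 3.12 and Remark 5.2] [cite: GayKirby2016, Remark 2] -/
theorem IsCircleProdSum.sum_handles_succ_eq_of_isGKTrisection_complexProjectivePlane {M : Type}
    [TopologicalSpace M] [T2Space M] [CompactSpace M] [ChartedSpace (EuclideanSpace ℝ (Fin 4)) M]
    [IsManifold (𝓡 4) ∞ M] (hM : IsCircleProdSum e M)
    (h : IsConnectedSum (𝓡 4) (𝓡 4) (𝓡 4) M ComplexProjectivePlane X)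
    (hT : IsGKTrisection X g k S) : k 0 + k 1 + k 2 + 1 = g + 2 * e := by
  have h1 := (finRelHomology_and_relEuler_of_isGKTrisection hT).2
  have h2 := (hM.relEuler_eq_of_isConnectedSum_complexProjectivePlane h).2
  rw [h1] at h2
  push_cast at h2
  omega

end Euler

/-! ### The inductive step with the exponents `k′ = min{k₂, k₃}` -/

section Step

variable {g g₁ g₂ : ℕ} {k k₁ k₂ : Fin 3 → ℕ} {X₁ X₂ X : Type}
  [TopologicalSpace X₁] [T2Space X₁] [SecondCountableTopology X₁]
  [ChartedSpace (EuclideanSpace ℝ (Fin 4)) X₁] [IsManifold (𝓡 4) ∞ X₁] [CompactSpace X₁]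
  [ConnectedSpace X₁]
  [TopologicalSpace X₂] [T2Space X₂] [SecondCountableTopology X₂]
  [ChartedSpace (EuclideanSpace ℝ (Fin 4)) X₂] [IsManifold (𝓡 4) ∞ X₂] [CompactSpace X₂]
  [ConnectedSpace X₂]
  [TopologicalSpace X] [T2Space X] [SecondCountableTopology X]
  [ChartedSpace (EuclideanSpace ℝ (Fin 4)) X] [IsManifold (𝓡 4) ∞ X] [CompactSpace X]
  {S₁ : Fin 3 → Set X₁} {S₂ : Fin 3 → Set X₂}

/-- **The inductive step of MSZ's proof of Thm. 1.2, separating case, with the exponents.**  Let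
the closed `X` be a connected sum `X₁ # X₂` of closed connected smooth `4`-manifolds carrying
trisections of types `(g₁; k₁)`, `(g₂; k₂)` with `g₁ + g₂ = g` and `k₁ i + k₂ i = k i` (as
produced from a separating reducing curve, `Trisection.isConnectedSum_of_reducing_separating`),
with `kⱼ 0 ≤ gⱼ` (each `kᵢ` is at most the genus) and `g ≤ k 0 + 1` (the hypothesis
`k₁ ≥ g − 1` of the theorem, so that it holds for both pieces).  If both pieces satisfy the
conclusion of the theorem — `Xⱼ` is `#^{eⱼ}(S¹ × S³)` or `#^{eⱼ}(S¹ × S³) # ℂP²` with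
`eⱼ = min (kⱼ 1) (kⱼ 2)` — then so does `X`, with `k′ = min (k 1) (k 2)`: by the Euler
characteristic (`IsCircleProdSum.sum_handles_eq_of_isGKTrisection`,
`…_succ_eq_of_isGKTrisection_complexProjectivePlane`) the defects `kⱼ 1 + kⱼ 2 − 2eⱼ = |kⱼ 1 − kⱼ 2|`
and the `ℂP²` summands together cost at most `(g₁ − k₁ 0) + (g₂ − k₂ 0) ≤ 1`, so at most one
piece carries `ℂP²` (Remark 5.2) and `min` is additive, `k′ = e₁ + e₂`; the manifolds are
assembled by `msz_conclusion_of_isConnectedSum_right/left` (Kervaire–Milnor arithmetic).  ("By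
the inductive hypothesis, both `𝒯′` and `𝒯″` satisfy the conclusions of the theorem", MSZ §5.)
[cite: MeierSchirmerZupan2016, proof of Thm. 1.2 (§5) and Remark 5.2] -/
theorem msz_conclusion_of_splitting (hT₁ : IsGKTrisection X₁ g₁ k₁ S₁)
    (hT₂ : IsGKTrisection X₂ g₂ k₂ S₂) (hg : g₁ + g₂ = g) (hk : ∀ i, k₁ i + k₂ i = k i)
    (hb₁ : k₁ 0 ≤ g₁) (hb₂ : k₂ 0 ≤ g₂) (hk₀ : g ≤ k 0 + 1)
    (h₁ : IsCircleProdSum (min (k₁ 1) (k₁ 2)) X₁ ∨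
      ∃ (M : Type) (_ : TopologicalSpace M) (_ : T2Space M) (_ : SecondCountableTopology M)
        (_ : ChartedSpace (EuclideanSpace ℝ (Fin 4)) M) (_ : IsManifold (𝓡 4) ∞ M)
        (_ : CompactSpace M) (_ : ConnectedSpace M),
        IsCircleProdSum (min (k₁ 1) (k₁ 2)) M ∧
          IsConnectedSum (𝓡 4) (𝓡 4) (𝓡 4) M ComplexProjectivePlane X₁)
    (h₂ : IsCircleProdSum (min (k₂ 1) (k₂ 2)) X₂ ∨
      ∃ (M : Type) (_ : TopologicalSpace M) (_ : T2Space M) (_ : SecondCountableTopology M)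
        (_ : ChartedSpace (EuclideanSpace ℝ (Fin 4)) M) (_ : IsManifold (𝓡 4) ∞ M)
        (_ : CompactSpace M) (_ : ConnectedSpace M),
        IsCircleProdSum (min (k₂ 1) (k₂ 2)) M ∧
          IsConnectedSum (𝓡 4) (𝓡 4) (𝓡 4) M ComplexProjectivePlane X₂)
    (h : IsConnectedSum (𝓡 4) (𝓡 4) (𝓡 4) X₁ X₂ X) :
    IsCircleProdSum (min (k 1) (k 2)) X ∨
      ∃ (M : Type) (_ : TopologicalSpace M) (_ : T2Space M) (_ : SecondCountableTopology M)
        (_ : ChartedSpace (EuclideanSpace ℝ (Fin 4)) M) (_ : IsManifold (𝓡 4) ∞ M)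
        (_ : CompactSpace M) (_ : ConnectedSpace M),
        IsCircleProdSum (min (k 1) (k 2)) M ∧
          IsConnectedSum (𝓡 4) (𝓡 4) (𝓡 4) M ComplexProjectivePlane X := by
  have hk0 := hk 0
  have hk1 := hk 1
  have hk2 := hk 2
  have hm₁ : min (k₁ 1) (k₁ 2) ≤ k₁ 1 ∧ min (k₁ 1) (k₁ 2) ≤ k₁ 2 := ⟨min_le_left _ _, min_le_right _ _⟩
  have hm₂ : min (k₂ 1) (k₂ 2) ≤ k₂ 1 ∧ min (k₂ 1) (k₂ 2) ≤ k₂ 2 := ⟨min_le_left _ _, min_le_right _ _⟩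
  rcases h₁ with h₁ | ⟨M₁, _, _, _, _, _, _, _, hM₁, hM₁C⟩ <;>
    rcases h₂ with h₂ | ⟨M₂, _, _, _, _, _, _, _, hM₂, hM₂C⟩
  · -- both pieces are `#(S¹ × S³)`'s
    have e₁ := h₁.sum_handles_eq_of_isGKTrisection hT₁
    have e₂ := h₂.sum_handles_eq_of_isGKTrisection hT₂
    have hmin : min (k 1) (k 2) = min (k₁ 1) (k₁ 2) + min (k₂ 1) (k₂ 2) := by omega
    rw [hmin]
    exact Or.inl (h₁.add _ h₂ h)
  · -- `X₂` carries `ℂP²`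
    have e₁ := h₁.sum_handles_eq_of_isGKTrisection hT₁
    have e₂ := hM₂.sum_handles_succ_eq_of_isGKTrisection_complexProjectivePlane hM₂C hT₂
    have hmin : min (k 1) (k 2) = min (k₁ 1) (k₁ 2) + min (k₂ 1) (k₂ 2) := by omega
    rw [hmin]
    exact msz_conclusion_of_isConnectedSum_left h₁
      (Or.inr ⟨M₂, ‹_›, ‹_›, ‹_›, ‹_›, ‹_›, ‹_›, ‹_›, hM₂, hM₂C⟩) h
  · -- `X₁` carries `ℂP²`
    have e₁ := hM₁.sum_handles_succ_eq_of_isGKTrisection_complexProjectivePlane hM₁C hT₁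
    have e₂ := h₂.sum_handles_eq_of_isGKTrisection hT₂
    have hmin : min (k 1) (k 2) = min (k₁ 1) (k₁ 2) + min (k₂ 1) (k₂ 2) := by omega
    rw [hmin]
    exact msz_conclusion_of_isConnectedSum_right
      (Or.inr ⟨M₁, ‹_›, ‹_›, ‹_›, ‹_›, ‹_›, ‹_›, ‹_›, hM₁, hM₁C⟩) h₂ h
  · -- two `ℂP²` summands are excluded by the Euler characteristic (Remark 5.2)
    exfalso
    have e₁ := hM₁.sum_handles_succ_eq_of_isGKTrisection_complexProjectivePlane hM₁C hT₁
    have e₂ := hM₂.sum_handles_succ_eq_of_isGKTrisection_complexProjectivePlane hM₂C hT₂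
    omega

omit [ConnectedSpace X₁] [TopologicalSpace X₂] [T2Space X₂] [SecondCountableTopology X₂]
  [ChartedSpace (EuclideanSpace ℝ (Fin 4)) X₂] [IsManifold (𝓡 4) ∞ X₂] [CompactSpace X₂]
  [ConnectedSpace X₂] in
/-- **The inductive step of MSZ's proof of Thm. 1.2, non-separating case, with the exponents.**
If the closed `X` is a connected sum `X₁ # (S¹ × S³)` (Mathlib's `Circle × 𝕊³`; as produced from
a non-separating reducing curve, `Trisection.isConnectedSum_circleProd_of_reducing_nonseparating`,
the piece having type `(g − 1; k − 1)`: `k₁ i + 1 = k i`) and the closed connected smooth `X₁`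
is `#^{e₁}(S¹ × S³)` or `#^{e₁}(S¹ × S³) # ℂP²` with `e₁ = min (k₁ 1) (k₁ 2)`, then `X` satisfies
the conclusion with `k′ = min (k 1) (k 2) = e₁ + 1` (`msz_conclusion_of_isConnectedSum_circleProd`).
[cite: MeierSchirmerZupan2016, proof of Thm. 1.2 (§5)] -/
theorem msz_conclusion_of_splitting_circleProd [ConnectedSpace X₁] (hk : ∀ i, k₁ i + 1 = k i)
    (h₁ : IsCircleProdSum (min (k₁ 1) (k₁ 2)) X₁ ∨
      ∃ (M : Type) (_ : TopologicalSpace M) (_ : T2Space M) (_ : SecondCountableTopology M)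
        (_ : ChartedSpace (EuclideanSpace ℝ (Fin 4)) M) (_ : IsManifold (𝓡 4) ∞ M)
        (_ : CompactSpace M) (_ : ConnectedSpace M),
        IsCircleProdSum (min (k₁ 1) (k₁ 2)) M ∧
          IsConnectedSum (𝓡 4) (𝓡 4) (𝓡 4) M ComplexProjectivePlane X₁)
    (h : IsConnectedSum (𝓡 4) (𝓡 4) ((𝓡 1).prod (𝓡 3)) X₁
      (Circle × (Metric.sphere (0 : EuclideanSpace ℝ (Fin 4)) 1)) X) :
    IsCircleProdSum (min (k 1) (k 2)) X ∨
      ∃ (M : Type) (_ : TopologicalSpace M) (_ : T2Space M) (_ : SecondCountableTopology M)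
        (_ : ChartedSpace (EuclideanSpace ℝ (Fin 4)) M) (_ : IsManifold (𝓡 4) ∞ M)
        (_ : CompactSpace M) (_ : ConnectedSpace M),
        IsCircleProdSum (min (k 1) (k 2)) M ∧
          IsConnectedSum (𝓡 4) (𝓡 4) (𝓡 4) M ComplexProjectivePlane X := by
  have hk1 := hk 1
  have hk2 := hk 2
  have hmin : min (k 1) (k 2) = min (k₁ 1) (k₁ 2) + 1 := by omega
  rw [hmin]
  exact msz_conclusion_of_isConnectedSum_circleProd h₁ h

end Step

/-! ### The whole induction, modulo reducibility and the genus-`≤ 1` base -/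

section Reduction

variable {g g₁ g₂ : ℕ} {k k₁ k₂ : Fin 3 → ℕ} {X₁ X₂ X : Type}
  [TopologicalSpace X₁] [T2Space X₁] [SecondCountableTopology X₁]
  [ChartedSpace (EuclideanSpace ℝ (Fin 4)) X₁] [IsManifold (𝓡 4) ∞ X₁] [CompactSpace X₁]
  [ConnectedSpace X₁]
  [TopologicalSpace X₂] [T2Space X₂] [SecondCountableTopology X₂]
  [ChartedSpace (EuclideanSpace ℝ (Fin 4)) X₂] [IsManifold (𝓡 4) ∞ X₂] [CompactSpace X₂]
  [ConnectedSpace X₂]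
  [TopologicalSpace X] [T2Space X] [SecondCountableTopology X]
  [ChartedSpace (EuclideanSpace ℝ (Fin 4)) X] [IsManifold (𝓡 4) ∞ X] [CompactSpace X]
  {S₁ : Fin 3 → Set X₁} {S₂ : Fin 3 → Set X₂}

/-- `msz_conclusion_of_splitting` with the bounds `kⱼ 0 ≤ gⱼ` supplied by
`IsGKTrisection.le_genus` (`TrisectionOneHandlesLeGenus.lean`: each sector of a
`(g; k)`-trisection has at most `g` one-handles).
[cite: MeierSchirmerZupan2016, proof of Thm. 1.2 (§5) and Remark 5.2] -/
theorem msz_conclusion_of_splitting' (hT₁ : IsGKTrisection X₁ g₁ k₁ S₁)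
    (hT₂ : IsGKTrisection X₂ g₂ k₂ S₂) (hg : g₁ + g₂ = g) (hk : ∀ i, k₁ i + k₂ i = k i)
    (hk₀ : g ≤ k 0 + 1)
    (h₁ : IsCircleProdSum (min (k₁ 1) (k₁ 2)) X₁ ∨
      ∃ (M : Type) (_ : TopologicalSpace M) (_ : T2Space M) (_ : SecondCountableTopology M)
        (_ : ChartedSpace (EuclideanSpace ℝ (Fin 4)) M) (_ : IsManifold (𝓡 4) ∞ M)
        (_ : CompactSpace M) (_ : ConnectedSpace M),
        IsCircleProdSum (min (k₁ 1) (k₁ 2)) M ∧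
          IsConnectedSum (𝓡 4) (𝓡 4) (𝓡 4) M ComplexProjectivePlane X₁)
    (h₂ : IsCircleProdSum (min (k₂ 1) (k₂ 2)) X₂ ∨
      ∃ (M : Type) (_ : TopologicalSpace M) (_ : T2Space M) (_ : SecondCountableTopology M)
        (_ : ChartedSpace (EuclideanSpace ℝ (Fin 4)) M) (_ : IsManifold (𝓡 4) ∞ M)
        (_ : CompactSpace M) (_ : ConnectedSpace M),
        IsCircleProdSum (min (k₂ 1) (k₂ 2)) M ∧
          IsConnectedSum (𝓡 4) (𝓡 4) (𝓡 4) M ComplexProjectivePlane X₂)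
    (h : IsConnectedSum (𝓡 4) (𝓡 4) (𝓡 4) X₁ X₂ X) :
    IsCircleProdSum (min (k 1) (k 2)) X ∨
      ∃ (M : Type) (_ : TopologicalSpace M) (_ : T2Space M) (_ : SecondCountableTopology M)
        (_ : ChartedSpace (EuclideanSpace ℝ (Fin 4)) M) (_ : IsManifold (𝓡 4) ∞ M)
        (_ : CompactSpace M) (_ : ConnectedSpace M),
        IsCircleProdSum (min (k 1) (k 2)) M ∧
          IsConnectedSum (𝓡 4) (𝓡 4) (𝓡 4) M ComplexProjectivePlane X :=
  msz_conclusion_of_splitting hT₁ hT₂ hg hk (hT₁.le_genus 0) (hT₂.le_genus 0) hk₀ h₁ h₂ h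

end Reduction

/-- **MSZ's induction on `g` (proof of Thm. 1.2, §5), carried out: the theorem follows from the
reducibility of `(g; ≥ g − 1, ·, ·)`-trisections of genus `g ≥ 2`, the splitting of reducible
trisections, and the genus-`≤ 1` base.**  Printed: "We induct on `g` […]. It suffices to show
that `𝒯` is reducible, because this implies that `𝒯` can be written as a connected sum of a
`(g′; k′)`–trisection `𝒯′` and a `(g″; k″)`–trisection `𝒯″` […] By the inductive hypothesis,
both `𝒯′` and `𝒯″` satisfy the conclusions of the theorem."  Here the four inputs are, in
order: the two splitting facts of `ReducibleTrisectionSplitting.lean` (a reducing curve —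
`Trisection.IsReducible` — splits `X = X₁ # X₂` into trisected pieces of positive genera adding
to `g`, or `X = X₁ # (S¹ × S³)` with a piece of genus `g − 1`, according as it separates the
central surface or not; MSZ Prop. 3.5 and proof of Prop. 3.9), the reducibility statement that
is the heart of §5 (`hred`: MSZ Thm. 5.1 with Waldhausen's theorem — NOT in the tree, taken as a
hypothesis in the tree's vocabulary `Trisection.IsReducible`), and the base of the induction
(`hbase`, genus `≤ 1`: `(0; 0,0,0)` is `S⁴`, `(1; 1,1,1)` is `S¹ × S³`, `(1; 0,0,0)` is `±ℂP²`,
`(1; 1,0,0)` and its relabellings are `S⁴` — Gay–Kirby 2016 §1; NOT in the tree for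
`IsGKTrisection`).  GIVEN these, the fact `msz_trisection_classification_gk` holds in every
universe: strong induction on `g` at universe `0` — a piece `Xⱼ` of a connected sum of the
oriented `X` is orientable (`IsConnectedSum.isOrientable_left/right`,
`ConnectedSumSummandOrientation.lean`), inherits the hypothesis `gⱼ ≤ kⱼ 0 + 1` (from
`g ≤ k 0 + 1`, `k 0 = k₁ 0 + k₂ 0` and `kⱼ 0 ≤ gⱼ`, `IsGKTrisection.le_genus`), has smaller
genus, and the conclusions assemble by `msz_conclusion_of_splitting'` /
`msz_conclusion_of_splitting_circleProd` — then transport to universe `u`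
(`msz_trisection_classification_gk_of_univ`).  No statement of the fact is changed and nothing
is assumed about it: this theorem isolates exactly the two geometric inputs still missing from
the tree (reducibility; genus-`≤ 1` classification) next to the two recorded splitting facts.
[cite: MeierSchirmerZupan2016, Thm. 1.2 and its proof (§5), Thm. 5.1, Remark 5.2, Prop. 3.5]
[cite: GayKirby2016, §1 (genus `≤ 1` trisections)] -/
theorem msz_trisection_classification_gk_of_reducible
    (hsep : Trisection.isConnectedSum_of_reducing_separating.{0})
    (hnonsep : Trisection.isConnectedSum_circleProd_of_reducing_nonseparating.{0})
    (hred : ∀ (X : Type) [TopologicalSpace X] [T2Space X] [SecondCountableTopology X]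
      [ChartedSpace (EuclideanSpace ℝ (Fin 4)) X] [IsManifold (𝓡 4) ∞ X] [CompactSpace X]
      [ConnectedSpace X] (_ : SmoothOrientation (𝓡 4) X) (g : ℕ) (k : Fin 3 → ℕ)
      (S : Fin 3 → Set X), IsGKTrisection X g k S → 2 ≤ g → g ≤ k 0 + 1 →
        Trisection.IsReducible S)
    (hbase : ∀ (X : Type) [TopologicalSpace X] [T2Space X] [SecondCountableTopology X]
      [ChartedSpace (EuclideanSpace ℝ (Fin 4)) X] [IsManifold (𝓡 4) ∞ X] [CompactSpace X]
      [ConnectedSpace X] (_ : SmoothOrientation (𝓡 4) X) (g : ℕ) (k : Fin 3 → ℕ)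
      (S : Fin 3 → Set X), IsGKTrisection X g k S → g ≤ 1 →
        IsCircleProdSum (min (k 1) (k 2)) X ∨
          ∃ (M : Type) (_ : TopologicalSpace M) (_ : T2Space M) (_ : SecondCountableTopology M)
            (_ : ChartedSpace (EuclideanSpace ℝ (Fin 4)) M) (_ : IsManifold (𝓡 4) ∞ M)
            (_ : CompactSpace M) (_ : ConnectedSpace M),
            IsCircleProdSum (min (k 1) (k 2)) M ∧
              IsConnectedSum (𝓡 4) (𝓡 4) (𝓡 4) M ComplexProjectivePlane X) :
    msz_trisection_classification_gk.{u} := by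
  refine msz_trisection_classification_gk_of_univ (?_ : msz_trisection_classification_gk.{0})
  -- strong induction on the genus, at universe `0`
  suffices key : ∀ (n g : ℕ), g ≤ n → ∀ (X : Type) [TopologicalSpace X] [T2Space X]
      [SecondCountableTopology X] [ChartedSpace (EuclideanSpace ℝ (Fin 4)) X]
      [IsManifold (𝓡 4) ∞ X] [CompactSpace X] [ConnectedSpace X]
      (_ : SmoothOrientation (𝓡 4) X) (k : Fin 3 → ℕ) (S : Fin 3 → Set X),
      IsGKTrisection X g k S → g ≤ k 0 + 1 →
        IsCircleProdSum (min (k 1) (k 2)) X ∨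
          ∃ (M : Type) (_ : TopologicalSpace M) (_ : T2Space M) (_ : SecondCountableTopology M)
            (_ : ChartedSpace (EuclideanSpace ℝ (Fin 4)) M) (_ : IsManifold (𝓡 4) ∞ M)
            (_ : CompactSpace M) (_ : ConnectedSpace M),
            IsCircleProdSum (min (k 1) (k 2)) M ∧
              IsConnectedSum (𝓡 4) (𝓡 4) (𝓡 4) M ComplexProjectivePlane X by
    intro X _ _ _ _ _ _ _ o g k S hT hk
    exact key g g le_rfl X o k S hT hk
  intro n
  induction n with
  | zero =>
    intro g hg X _ _ _ _ _ _ _ o k S hT _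
    exact hbase X o g k S hT (by omega)
  | succ n ih =>
    intro g hg X _ _ _ _ _ _ _ o k S hT hk
    by_cases hg1 : g ≤ 1
    · exact hbase X o g k S hT hg1
    -- `g ≥ 2`: the trisection is reducible (MSZ §5), hence a connected sum of smaller ones
    obtain ⟨δ, hc, hess, hbd⟩ := hred X o g k S hT (by omega) hk
    have h2 : (2 : ℕ) ≤ 4 := by norm_num
    by_cases hns : Trisection.IsNonSeparating S δ
    · -- non-separating reducing curve: `X = X₁ # (S¹ × S³)`, `X₁` of type `(g − 1; k − 1)`
      obtain ⟨X₁, _, _, _, _, _, _, _, g₁, k₁, S₁, hT₁, hg₁, hk₁, hsum⟩ :=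
        hnonsep X o g k S δ hT hc hess hbd hns
      obtain ⟨o₁⟩ := hsum.isOrientable_left h2 ⟨o⟩
      have hk₁0 := hk₁ 0
      exact msz_conclusion_of_splitting_circleProd hk₁
        (ih g₁ (by omega) X₁ o₁ k₁ S₁ hT₁ (by omega)) hsum
    · -- separating reducing curve: `X = X₁ # X₂` with `g = g₁ + g₂`, `gⱼ ≥ 1`
      obtain ⟨X₁, _, _, _, _, _, _, _, X₂, _, _, _, _, _, _, _, g₁, g₂, k₁, k₂, S₁, S₂, hT₁, hT₂,
        hg', hg₁, hg₂, hkk, hsum⟩ := hsep X o g k S δ hT hc hess hbd hns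
      obtain ⟨o₁⟩ := hsum.isOrientable_left h2 ⟨o⟩
      obtain ⟨o₂⟩ := hsum.isOrientable_right h2 ⟨o⟩
      have hb₁ := hT₁.le_genus 0
      have hb₂ := hT₂.le_genus 0
      have hkk0 := hkk 0
      exact msz_conclusion_of_splitting' hT₁ hT₂ hg' hkk hk
        (ih g₁ (by omega) X₁ o₁ k₁ S₁ hT₁ (by omega))
        (ih g₂ (by omega) X₂ o₂ k₂ S₂ hT₂ (by omega)) hsum

/-- **MSZ's induction on `g` through SEPARATING reducing curves only** — the variant of
`msz_trisection_classification_gk_of_reducible` that does not use the non-separating splitting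
fact `Trisection.isConnectedSum_circleProd_of_reducing_nonseparating` (kept in
`ReducibleTrisectionSplitting.lean` as a frozen record, not to be proved as stated; see its
docstring).  Printed (proof of Thm. 1.2, §5): "It suffices to show that `𝒯` is reducible, because
this implies that `𝒯` can be written as a connected sum of a `(g′; k′)`–trisection `𝒯′` and a
`(g″; k″)`–trisection `𝒯″`, where `g = g′ + g″` and `g − 1 = k₁ = k₁′ + k₁″`" — i.e. the printed
induction only ever splits along a reducing curve that SEPARATES the central surface (a
decomposition `𝒯 = 𝒯′ # 𝒯″` with `g′, g″ ≥ 1`; for `g ≥ 2` a non-separating reducing curve `δ`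
yields the separating one `∂N(δ ∪ η)`, `η ⊂ Σ` a curve dual to `δ`, bounding in each handlebody
the band sum of two parallel copies of the disc bounded by `δ` — the standard remark behind the
quoted sentence).  So the inputs here are three: the separating splitting fact
`Trisection.isConnectedSum_of_reducing_separating` (MSZ Prop. 3.5 and proof of Prop. 3.9; at
universe `0`), the heart of §5 in the form "a `(g; ≥ g − 1, ·, ·)`-trisection of genus `g ≥ 2`
has a reducing curve separating the central surface" (`hred`: MSZ Thm. 5.1 with Waldhausen's
theorem and Lemma 4.4 — NOT in the tree, a hypothesis in the tree's vocabulary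
`Trisection.IsCurve` / `Trisection.BoundsDisc` / `Trisection.IsNonSeparating`, the hypothesis
shape of the separating fact verbatim), and the genus-`≤ 1` base (`hbase`, Gay–Kirby 2016 §1 —
NOT in the tree).  GIVEN these, `msz_trisection_classification_gk` holds in every universe, by
the same strong induction as `msz_trisection_classification_gk_of_reducible` with the
non-separating branch gone.  No statement of the fact is changed and nothing is assumed about it.
[cite: MeierSchirmerZupan2016, Thm. 1.2 and its proof (§5), Thm. 5.1, Lemma 4.4, Prop. 3.5, Remark 5.2]
[cite: GayKirby2016, §1 (genus `≤ 1` trisections)] -/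
theorem msz_trisection_classification_gk_of_separatingReducible
    (hsep : Trisection.isConnectedSum_of_reducing_separating.{0})
    (hred : ∀ (X : Type) [TopologicalSpace X] [T2Space X] [SecondCountableTopology X]
      [ChartedSpace (EuclideanSpace ℝ (Fin 4)) X] [IsManifold (𝓡 4) ∞ X] [CompactSpace X]
      [ConnectedSpace X] (_ : SmoothOrientation (𝓡 4) X) (g : ℕ) (k : Fin 3 → ℕ)
      (S : Fin 3 → Set X), IsGKTrisection X g k S → 2 ≤ g → g ≤ k 0 + 1 →
        ∃ δ : Set X, Trisection.IsCurve S δ ∧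
          ¬ (∃ e : Metric.closedBall (0 : EuclideanSpace ℝ (Fin 2)) 1 → X,
              Manifold.IsSmoothEmbedding (𝓡∂ 2) (𝓡 4) ∞ e ∧
              range e ⊆ Trisection.centralSurfaceSet S ∧
              e '' (𝓡∂ 2).boundary (Metric.closedBall (0 : EuclideanSpace ℝ (Fin 2)) 1) = δ) ∧
          (∀ q : Fin 3, Trisection.BoundsDisc S (Trisection.spineHandlebody S q) δ) ∧
          ¬ Trisection.IsNonSeparating S δ)
    (hbase : ∀ (X : Type) [TopologicalSpace X] [T2Space X] [SecondCountableTopology X]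
      [ChartedSpace (EuclideanSpace ℝ (Fin 4)) X] [IsManifold (𝓡 4) ∞ X] [CompactSpace X]
      [ConnectedSpace X] (_ : SmoothOrientation (𝓡 4) X) (g : ℕ) (k : Fin 3 → ℕ)
      (S : Fin 3 → Set X), IsGKTrisection X g k S → g ≤ 1 →
        IsCircleProdSum (min (k 1) (k 2)) X ∨
          ∃ (M : Type) (_ : TopologicalSpace M) (_ : T2Space M) (_ : SecondCountableTopology M)
            (_ : ChartedSpace (EuclideanSpace ℝ (Fin 4)) M) (_ : IsManifold (𝓡 4) ∞ M)
            (_ : CompactSpace M) (_ : ConnectedSpace M),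
            IsCircleProdSum (min (k 1) (k 2)) M ∧
              IsConnectedSum (𝓡 4) (𝓡 4) (𝓡 4) M ComplexProjectivePlane X) :
    msz_trisection_classification_gk.{u} := by
  refine msz_trisection_classification_gk_of_univ (?_ : msz_trisection_classification_gk.{0})
  -- strong induction on the genus, at universe `0`
  suffices key : ∀ (n g : ℕ), g ≤ n → ∀ (X : Type) [TopologicalSpace X] [T2Space X]
      [SecondCountableTopology X] [ChartedSpace (EuclideanSpace ℝ (Fin 4)) X]
      [IsManifold (𝓡 4) ∞ X] [CompactSpace X] [ConnectedSpace X]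
      (_ : SmoothOrientation (𝓡 4) X) (k : Fin 3 → ℕ) (S : Fin 3 → Set X),
      IsGKTrisection X g k S → g ≤ k 0 + 1 →
        IsCircleProdSum (min (k 1) (k 2)) X ∨
          ∃ (M : Type) (_ : TopologicalSpace M) (_ : T2Space M) (_ : SecondCountableTopology M)
            (_ : ChartedSpace (EuclideanSpace ℝ (Fin 4)) M) (_ : IsManifold (𝓡 4) ∞ M)
            (_ : CompactSpace M) (_ : ConnectedSpace M),
            IsCircleProdSum (min (k 1) (k 2)) M ∧
              IsConnectedSum (𝓡 4) (𝓡 4) (𝓡 4) M ComplexProjectivePlane X by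
    intro X _ _ _ _ _ _ _ o g k S hT hk
    exact key g g le_rfl X o k S hT hk
  intro n
  induction n with
  | zero =>
    intro g hg X _ _ _ _ _ _ _ o k S hT _
    exact hbase X o g k S hT (by omega)
  | succ n ih =>
    intro g hg X _ _ _ _ _ _ _ o k S hT hk
    by_cases hg1 : g ≤ 1
    · exact hbase X o g k S hT hg1
    -- `g ≥ 2`: a separating reducing curve (MSZ §5), hence `X = X₁ # X₂` with `g = g₁ + g₂`,
    -- `gⱼ ≥ 1`, and the induction hypothesis applies to both pieces
    obtain ⟨δ, hc, hess, hbd, hns⟩ := hred X o g k S hT (by omega) hk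
    have h2 : (2 : ℕ) ≤ 4 := by norm_num
    obtain ⟨X₁, _, _, _, _, _, _, _, X₂, _, _, _, _, _, _, _, g₁, g₂, k₁, k₂, S₁, S₂, hT₁, hT₂,
      hg', hg₁, hg₂, hkk, hsum⟩ := hsep X o g k S δ hT hc hess hbd hns
    obtain ⟨o₁⟩ := hsum.isOrientable_left h2 ⟨o⟩
    obtain ⟨o₂⟩ := hsum.isOrientable_right h2 ⟨o⟩
    have hb₁ := hT₁.le_genus 0
    have hb₂ := hT₂.le_genus 0
    have hkk0 := hkk 0
    exact msz_conclusion_of_splitting' hT₁ hT₂ hg' hkk hk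
      (ih g₁ (by omega) X₁ o₁ k₁ S₁ hT₁ (by omega))
      (ih g₂ (by omega) X₂ o₂ k₂ S₂ hT₂ (by omega)) hsum

/-! ### The genus-`≤ 1` base, from the classification of genus-`≤ 1` trisections -/

section Base

/-- **A manifold diffeomorphic to `ℂP²` is `S⁴ # ℂP²` in the shape of the fact's second
disjunct**: `∃ M` closed connected smooth with `IsCircleProdSum 0 M` and `IsConnectedSum M ℂP² X`
— take `M = 𝕊⁴` (`IsCircleProdSum.sphere_self`), `ℂP² = ℂP² # 𝕊⁴` (Kervaire–Milnor's identity
element, the tree's proved `isConnectedSum_sphere_self_holds`), symmetrised and transported along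
`ℂP² ≅ X` (`IsConnectedSum.symm`, `IsConnectedSum.of_diffeomorph`).  As unoriented smooth
manifolds `ℂP²‾ ≅ ℂP²`, so this covers both genus-one trisections of type `(1; 0, 0, 0)`.
[cite: KervaireMilnor1963, §2, Lemma 2.1 ("Sⁿ serves as identity element")]
[cite: MeierSchirmerZupan2016, §3 (the balanced genus one trisections: ℂP², ℂP²‾, S¹ × S³)] -/
theorem msz_conclusion_of_diffeomorph_complexProjectivePlane {X : Type} [TopologicalSpace X]
    [ChartedSpace (EuclideanSpace ℝ (Fin 4)) X] [IsManifold (𝓡 4) ∞ X]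
    (e : X ≃ₘ⟮𝓡 4, 𝓡 4⟯ ComplexProjectivePlane) :
    ∃ (M : Type) (_ : TopologicalSpace M) (_ : T2Space M) (_ : SecondCountableTopology M)
      (_ : ChartedSpace (EuclideanSpace ℝ (Fin 4)) M) (_ : IsManifold (𝓡 4) ∞ M)
      (_ : CompactSpace M) (_ : ConnectedSpace M),
      IsCircleProdSum 0 M ∧ IsConnectedSum (𝓡 4) (𝓡 4) (𝓡 4) M ComplexProjectivePlane X := by
  haveI : ConnectedSpace (Metric.sphere (0 : EuclideanSpace ℝ (Fin 5)) 1) := by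
    refine isConnected_iff_connectedSpace.mp (isConnected_sphere ?_ 0 zero_le_one)
    rw [← Module.finrank_eq_rank, finrank_euclideanSpace_fin]
    norm_num
  have h : IsConnectedSum (𝓡 4) (𝓡 4) (𝓡 4) ComplexProjectivePlane
      (Metric.sphere (0 : EuclideanSpace ℝ (Fin 5)) 1) ComplexProjectivePlane :=
    isConnectedSum_sphere_self_holds (n := 4) ComplexProjectivePlane
  exact ⟨Metric.sphere (0 : EuclideanSpace ℝ (Fin 5)) 1, inferInstance, inferInstance,
    inferInstance, inferInstance, inferInstance, inferInstance, inferInstance,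
    IsCircleProdSum.sphere_self, h.symm.of_diffeomorph e.symm⟩

/-- **The base of MSZ's induction from the classification of trisections of genus `≤ 1`.**
Printed (MSZ, proof of Thm. 1.2): "If `g = 1`, the statement follows from the classification of
genus one trisections"; (§3, p. 6): "all six of the genus one trisections are standard. The three
possibilities in the balanced case […] correspond to `ℂP²`, `ℂP²‾`, and `S¹ × S³`. The three
unbalanced genus one trisections of `S⁴` […] correspond to the three stabilization operations";
and a genus-zero trisection is the `(0; 0)`-trisection of `S⁴` (Gay–Kirby 2016, §2).  GIVEN
these classifications at the level of the underlying manifolds — `h0`: a closed connected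
oriented `X` with a genus-`0` GK-trisection is diffeomorphic to `𝕊⁴`; `h1`: with a genus-`1`
GK-trisection of type `(1; k)`, EITHER `k 0 + k 1 + k 2 = 1` and `X ≅ 𝕊⁴`, OR `k = (0, 0, 0)`
and `X ≅ ℂP²` (as an unoriented manifold, covering `ℂP²‾`), OR `k = (1, 1, 1)` and `X ≅ S¹ × S³`
(Mathlib's `Circle × 𝕊³`); no genus-one trisection has `k 0 + k 1 + k 2 = 2` — NEITHER of which
is in the tree, the hypothesis `hbase` of `msz_trisection_classification_gk_of_reducible` /
`…_of_separatingReducible` holds: case by case, `#⁰(S¹ × S³) = S⁴` (`IsCircleProdSum.sphere`),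
`ℂP² = S⁴ # ℂP²` (`msz_conclusion_of_diffeomorph_complexProjectivePlane`), `S¹ × S³ = #¹(S¹ × S³)`
(`IsCircleProdSum.one_of_diffeomorph`), with `k′ = min (k 1) (k 2)` evaluated (`kᵢ ≤ g`,
`IsGKTrisection.le_genus`, at `g = 0`).
[cite: MeierSchirmerZupan2016, proof of Thm. 1.2 (§5) and §3 (p. 6, the six genus one trisections)]
[cite: GayKirby2016, §2 (genus zero and genus one trisections)] -/
theorem msz_base_of_genus_le_one
    (h0 : ∀ (X : Type) [TopologicalSpace X] [T2Space X] [SecondCountableTopology X]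
      [ChartedSpace (EuclideanSpace ℝ (Fin 4)) X] [IsManifold (𝓡 4) ∞ X] [CompactSpace X]
      [ConnectedSpace X] (_ : SmoothOrientation (𝓡 4) X) (k : Fin 3 → ℕ) (S : Fin 3 → Set X),
      IsGKTrisection X 0 k S →
        Nonempty (X ≃ₘ⟮𝓡 4, 𝓡 4⟯ Metric.sphere (0 : EuclideanSpace ℝ (Fin 5)) 1))
    (h1 : ∀ (X : Type) [TopologicalSpace X] [T2Space X] [SecondCountableTopology X]
      [ChartedSpace (EuclideanSpace ℝ (Fin 4)) X] [IsManifold (𝓡 4) ∞ X] [CompactSpace X]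
      [ConnectedSpace X] (_ : SmoothOrientation (𝓡 4) X) (k : Fin 3 → ℕ) (S : Fin 3 → Set X),
      IsGKTrisection X 1 k S →
        (k 0 + k 1 + k 2 = 1 ∧
            Nonempty (X ≃ₘ⟮𝓡 4, 𝓡 4⟯ Metric.sphere (0 : EuclideanSpace ℝ (Fin 5)) 1)) ∨
          ((∀ i, k i = 0) ∧ Nonempty (X ≃ₘ⟮𝓡 4, 𝓡 4⟯ ComplexProjectivePlane)) ∨
          ((∀ i, k i = 1) ∧ Nonempty (X ≃ₘ⟮𝓡 4, (𝓡 1).prod (𝓡 3)⟯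
            (Circle × (Metric.sphere (0 : EuclideanSpace ℝ (Fin 4)) 1)))))
    (X : Type) [TopologicalSpace X] [T2Space X] [SecondCountableTopology X]
    [ChartedSpace (EuclideanSpace ℝ (Fin 4)) X] [IsManifold (𝓡 4) ∞ X] [CompactSpace X]
    [ConnectedSpace X] (o : SmoothOrientation (𝓡 4) X) (g : ℕ) (k : Fin 3 → ℕ)
    (S : Fin 3 → Set X) (hT : IsGKTrisection X g k S) (hg : g ≤ 1) :
    IsCircleProdSum (min (k 1) (k 2)) X ∨
      ∃ (M : Type) (_ : TopologicalSpace M) (_ : T2Space M) (_ : SecondCountableTopology M)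
        (_ : ChartedSpace (EuclideanSpace ℝ (Fin 4)) M) (_ : IsManifold (𝓡 4) ∞ M)
        (_ : CompactSpace M) (_ : ConnectedSpace M),
        IsCircleProdSum (min (k 1) (k 2)) M ∧
          IsConnectedSum (𝓡 4) (𝓡 4) (𝓡 4) M ComplexProjectivePlane X := by
  interval_cases g
  · -- genus `0`: `k = (0, 0, 0)` and `X ≅ S⁴ = #⁰(S¹ × S³)`
    obtain ⟨e⟩ := h0 X o k S hT
    have h1' := hT.le_genus 1
    have hmin : min (k 1) (k 2) = 0 := by omega
    rw [hmin]
    exact Or.inl (.sphere e)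
  · -- genus `1`: the six genus one trisections
    rcases h1 X o k S hT with ⟨hk, ⟨e⟩⟩ | ⟨hk, ⟨e⟩⟩ | ⟨hk, ⟨e⟩⟩
    · -- unbalanced, `X ≅ S⁴`
      have hmin : min (k 1) (k 2) = 0 := by omega
      rw [hmin]
      exact Or.inl (.sphere e)
    · -- `(1; 0, 0, 0)`, `X ≅ ℂP²` (or `ℂP²‾`)
      have hmin : min (k 1) (k 2) = 0 := by rw [hk 1, hk 2]; rfl
      rw [hmin]
      exact Or.inr (msz_conclusion_of_diffeomorph_complexProjectivePlane e)
    · -- `(1; 1, 1, 1)`, `X ≅ S¹ × S³`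
      have hmin : min (k 1) (k 2) = 1 := by rw [hk 1, hk 2]; rfl
      rw [hmin]
      exact Or.inl (IsCircleProdSum.one_of_diffeomorph e)

end Base

/-- **MSZ Thm. 1.2 from its three printed inputs, each in the shape of a classification
statement**: the separating splitting fact `Trisection.isConnectedSum_of_reducing_separating`
(MSZ Prop. 3.5 / proof of Prop. 3.9), a separating reducing curve for every
`(g; ≥ g − 1, ·, ·)`-trisection of genus `g ≥ 2` (MSZ §5: Thm. 5.1, Waldhausen, Lemma 4.4), and
the classification of GK-trisections of genus `0` (`X ≅ S⁴`) and genus `1` (the six genus one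
trisections: `S⁴` thrice, `ℂP²`, `ℂP²‾`, `S¹ × S³`) at the level of the underlying manifolds —
`msz_trisection_classification_gk_of_separatingReducible` over `msz_base_of_genus_le_one`.  None
of the three inputs is in the tree; nothing about the fact is assumed.
[cite: MeierSchirmerZupan2016, Thm. 1.2 and its proof (§5); §3 (p. 6)]
[cite: GayKirby2016, §2 (genus zero and genus one trisections)] -/
theorem msz_trisection_classification_gk_of_separatingReducible_of_genus_le_one
    (hsep : Trisection.isConnectedSum_of_reducing_separating.{0})
    (hred : ∀ (X : Type) [TopologicalSpace X] [T2Space X] [SecondCountableTopology X]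
      [ChartedSpace (EuclideanSpace ℝ (Fin 4)) X] [IsManifold (𝓡 4) ∞ X] [CompactSpace X]
      [ConnectedSpace X] (_ : SmoothOrientation (𝓡 4) X) (g : ℕ) (k : Fin 3 → ℕ)
      (S : Fin 3 → Set X), IsGKTrisection X g k S → 2 ≤ g → g ≤ k 0 + 1 →
        ∃ δ : Set X, Trisection.IsCurve S δ ∧
          ¬ (∃ e : Metric.closedBall (0 : EuclideanSpace ℝ (Fin 2)) 1 → X,
              Manifold.IsSmoothEmbedding (𝓡∂ 2) (𝓡 4) ∞ e ∧
              range e ⊆ Trisection.centralSurfaceSet S ∧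
              e '' (𝓡∂ 2).boundary (Metric.closedBall (0 : EuclideanSpace ℝ (Fin 2)) 1) = δ) ∧
          (∀ q : Fin 3, Trisection.BoundsDisc S (Trisection.spineHandlebody S q) δ) ∧
          ¬ Trisection.IsNonSeparating S δ)
    (h0 : ∀ (X : Type) [TopologicalSpace X] [T2Space X] [SecondCountableTopology X]
      [ChartedSpace (EuclideanSpace ℝ (Fin 4)) X] [IsManifold (𝓡 4) ∞ X] [CompactSpace X]
      [ConnectedSpace X] (_ : SmoothOrientation (𝓡 4) X) (k : Fin 3 → ℕ) (S : Fin 3 → Set X),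
      IsGKTrisection X 0 k S →
        Nonempty (X ≃ₘ⟮𝓡 4, 𝓡 4⟯ Metric.sphere (0 : EuclideanSpace ℝ (Fin 5)) 1))
    (h1 : ∀ (X : Type) [TopologicalSpace X] [T2Space X] [SecondCountableTopology X]
      [ChartedSpace (EuclideanSpace ℝ (Fin 4)) X] [IsManifold (𝓡 4) ∞ X] [CompactSpace X]
      [ConnectedSpace X] (_ : SmoothOrientation (𝓡 4) X) (k : Fin 3 → ℕ) (S : Fin 3 → Set X),
      IsGKTrisection X 1 k S →
        (k 0 + k 1 + k 2 = 1 ∧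
            Nonempty (X ≃ₘ⟮𝓡 4, 𝓡 4⟯ Metric.sphere (0 : EuclideanSpace ℝ (Fin 5)) 1)) ∨
          ((∀ i, k i = 0) ∧ Nonempty (X ≃ₘ⟮𝓡 4, 𝓡 4⟯ ComplexProjectivePlane)) ∨
          ((∀ i, k i = 1) ∧ Nonempty (X ≃ₘ⟮𝓡 4, (𝓡 1).prod (𝓡 3)⟯
            (Circle × (Metric.sphere (0 : EuclideanSpace ℝ (Fin 4)) 1))))) :
    msz_trisection_classification_gk.{u} :=
  msz_trisection_classification_gk_of_separatingReducible hsep hred (msz_base_of_genus_le_one h0 h1)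

end Literature.Topology.FourManifolds

end
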